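import Summits.Schanuel.Schanuel.Theorems.RootDecomp1EMultiplierFieldMembers

/-!
# RootDecomp1EMultiplierFieldDictionary — part 3/4 of the port of lens-2 gen 12 «MULTIPLIER FIELD» (ROUND 12 of route-Schanuel-RootDecomp1E, THEOREM ROUND)

§3c: the dictionary with round 11's grid cell — on ℚ-free quadruples FullGridFour ⟺ IsKLine (multiplierSubalgebra, primitive element); Conjecture 2.3 inert on the K-module cell.

Port (census-1 gen 8) of HOME/decomp-schanuel-lens-2/g12/MultiplierField.lean (sha256 5884507d…, 910 l; critic VERDICT 2026-08-30T15:36:56Z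
ACCEPTED — PATH T, port CLEARED with hygiene h1–h4: the two unused simp arguments dropped; cell predicates are DEFINITIONS of this
decomposition (not cited facts); the tree theorems `smallTrdeg_thm_2_9_pos` / `nesterenko` stay explicit binders h29 / hN as in
RootDecomp1EEStableRung; `closes` kept, informational). Namespace `Summit.Schanuel.Schanuel.Theorems.RootDecomp1EMultiplierField` (node: …Theses.MultiplierField);
statements and proofs verbatim. `--supports stmt-Schanuel-31409` (EStableDefectOne, the CM type). Sorry-free; standard axioms.
Nothing here proves Schanuel; rung 0.
-/

set_option linter.dupNamespace false

namespace Summit.Schanuel.Schanuel.Theorems.RootDecomp1EMultiplierField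


open Complex IntermediateField Module Polynomial
open Summit.Schanuel.Schanuel.Theses.RootDecomp1E (DefectOneSchanuel EStableDefectOne PlainDefectOne
  ClosedFormAtomSchanuel AlgAnchoredDarkAtomSchanuel LineLogDarkAtomSchanuel DeepLogDarkAtomSchanuel
  OffAxisClosure FreeDarkAtomSchanuel)
open Summit.Schanuel.Schanuel.Theorems.RootDecomp1EAnchor (isAlgebraic_of_mem_adjoin trdeg_adjoin_le_of_isAlgebraic
  mem_adjoin_of_mem_span exp_isAlgebraic_of_mem_span trdeg_le_of_mem_span trdeg_eq_of_span_eq offAxisClosure_holds)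
open Summit.Schanuel.Schanuel.Theorems.RootDecomp1EEStableStructure (degree_dvd eStable_structure eStable_prime_isLine)
open Summit.Schanuel.Schanuel.Theorems.RootDecomp1EEStableRung (defectOne_of_le_two mul_mem_span_of_gens
  one_beta_linearIndependent two_le_trdeg_of_eStable_three)
open Summit.Schanuel.Schanuel.Theorems.RootDecomp1EDefectOneSplit (defectOneSchanuelGlue_holds)
open Summit.Schanuel.Schanuel.Theorems.RootDecomp1EModuleType (SubMinimalDefect)
open Summit.Schanuel.Schanuel.Theorems.RootDecomp1EModuleGrids (rat_mul_pi_eq_rat)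
open Summit.Schanuel.Schanuel.Theorems.RootDecomp1EMultiplicationTypeLeaves (defectOne_quarticLine_of_conj23
  two_le_trdeg_of_eStable sub_two_le_trdeg_of_subMinimal)
open Summit.Schanuel.Schanuel.Theorems.RootDecomp1ELevels (LWLevel le_trdeg_of_algebraicIndependent le_trdeg_of_lwLevel)
open Literature.Barriers.Schanuel (smallTrdeg_thm_2_9_pos WaldschmidtConjecture_2_3 isAlgebraic_I)
open Literature.NumberTheory.Transcendental (nesterenko transcendental_pi_holds algebraicIndependent_exp_holds)

noncomputable section

/-! ### §3c THE DICTIONARY WITH ROUND 11's GRID CELL: at `n = 4`, FULL `(4,4)` SPAN-GRID ⟺ K-LINE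
Hence Conjecture 2.3 — whose `t₂`-output reaches `3 = n − 1` ONLY on full grids (tree `conj23_t₂_eq_three_only_fullGrid`)
— bites EXACTLY the K-line cell of the CM type; the K-MODULE cell is Conjecture-2.3-BLIND as a cell. -/

/-- Powers `1, β, …, β^{n−1}` of an algebraic number of degree `n` are ℚ-free. -/
theorem pow_linearIndependent_of_natDegree {β : ℂ} {n : ℕ} (hd : (minpoly ℚ β).natDegree = n) :
    LinearIndependent ℚ (fun k : Fin n => β ^ (k : ℕ)) := by
  have hcomp : (fun i : Fin (minpoly ℚ β).natDegree => β ^ (i : ℕ)) ∘ (finCongr hd.symm) =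
      fun k : Fin n => β ^ (k : ℕ) := by
    funext k; simp
  rw [← hcomp]
  exact (linearIndependent_pow (K := ℚ) β).comp _ (finCongr hd.symm).injective

/-- All powers `β^m λ` stay in an E-stable span containing `λ`. -/
theorem pow_mul_mem_span {n : ℕ} {z : Fin n → ℂ} {β lam : ℂ} (hβV : ∀ i, β * z i ∈ Submodule.span ℚ (Set.range z))
    (hlam : lam ∈ Submodule.span ℚ (Set.range z)) : ∀ m : ℕ, β ^ m * lam ∈ Submodule.span ℚ (Set.range z) := by
  intro m
  induction m with
  | zero => simpa using hlam
  | succ m ih =>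
    have := mul_mem_span_of_gens hβV ih
    convert this using 1
    ring

/-- **K-LINE ⟹ FULL GRID**: `x = (1, β, β², β³)`, `y = (λ, βλ, β²λ, β³λ)`. -/
theorem fullGridFour_of_kline {z : Fin 4 → ℂ} (hz : LinearIndependent ℚ z) (hK : IsKLine z) :
    Summit.Schanuel.Schanuel.Theorems.RootDecomp1ELevels.FullGridFour z := by
  obtain ⟨β, lam, hβ, hd, hlam, hβV, hli, -⟩ := line_of_kline (by norm_num) hz hK
  refine ⟨fun i : Fin 4 => β ^ (i : ℕ), fun k : Fin 4 => β ^ (k : ℕ) * lam,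
    pow_linearIndependent_of_natDegree hd, hli, fun i j => ?_⟩
  have := pow_mul_mem_span hβV hlam ((i : ℕ) + (j : ℕ))
  convert this using 1
  ring

/-- **THE MULTIPLIER ALGEBRA** of a ℚ-subspace `V ⊆ ℂ`: `{γ : γV ⊆ V}`, a ℚ-subalgebra of `ℂ`. -/
def multiplierSubalgebra (V : Submodule ℚ ℂ) : Subalgebra ℚ ℂ where
  carrier := {γ | ∀ v ∈ V, γ * v ∈ V}
  mul_mem' := by
    intro a b ha hb v hv
    rw [mul_assoc]
    exact ha _ (hb v hv)
  one_mem' := by intro v hv; simpa using hv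
  add_mem' := by
    intro a b ha hb v hv
    rw [add_mul]
    exact V.add_mem (ha v hv) (hb v hv)
  zero_mem' := by intro v hv; simp
  algebraMap_mem' := by
    intro q v hv
    rw [← Algebra.smul_def]
    exact V.smul_mem q hv

/-- `Submodule ℚ ℂ} {γ : ℂ} : γ ∈ multiplierSubalgebra V ↔ ∀ v ∈ V, γ * v ∈ V`. -/
theorem mem_multiplierSubalgebra {V : Submodule ℚ ℂ} {γ : ℂ} : γ ∈ multiplierSubalgebra V ↔ ∀ v ∈ V, γ * v ∈ V :=
  Iff.rfl

/-- Stabilising the generators stabilises the span. -/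
theorem mem_multiplierSubalgebra_span {n : ℕ} {z : Fin n → ℂ} {γ : ℂ}
    (hγ : ∀ i, γ * z i ∈ Submodule.span ℚ (Set.range z)) : γ ∈ multiplierSubalgebra (Submodule.span ℚ (Set.range z)) := by
  intro v hv
  refine Submodule.span_induction (fun w hw => ?_) (by simp) (fun a c _ _ ha hc => ?_) (fun q a _ ha => ?_) hv
  · obtain ⟨i, rfl⟩ := hw
    exact hγ i
  · rw [mul_add]; exact add_mem ha hc
  · rw [mul_smul_comm]; exact Submodule.smul_mem _ q ha

/-- **FULL GRID ⟹ K-LINE.**  Normalise the grid so that the `yⱼ/y₀` are four ℚ-free MULTIPLIERS of `V = span_ℚ z`;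
the number field `K = ℚ(y/y₀)` they generate consists of multipliers, has `[K:ℚ] ≥ 4`, and a primitive element of `K`
is a multiplier of degree `[K:ℚ]`, which divides `4` (tree `degree_dvd`): so `[K:ℚ] = 4` and `V` is a K-line. -/
theorem kline_of_fullGridFour {z : Fin 4 → ℂ} (hz : LinearIndependent ℚ z)
    (hg : Summit.Schanuel.Schanuel.Theorems.RootDecomp1ELevels.FullGridFour z) : IsKLine z := by
  classical
  obtain ⟨x, y, hx, hy, hgrid⟩ := hg
  set V : Submodule ℚ ℂ := Submodule.span ℚ (Set.range z) with hV
  set X : Submodule ℚ ℂ := Submodule.span ℚ (Set.range x) with hX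
  haveI : FiniteDimensional ℚ ↥V := FiniteDimensional.span_of_finite ℚ (Set.finite_range _)
  haveI : FiniteDimensional ℚ ↥X := FiniteDimensional.span_of_finite ℚ (Set.finite_range _)
  have hVn : Module.finrank ℚ ↥V = 4 := by simpa using finrank_span_eq_card hz
  have hXn : Module.finrank ℚ ↥X = 4 := by simpa using finrank_span_eq_card hx
  have hyne : ∀ j, y j ≠ 0 := fun j => hy.ne_zero j
  have hU : ∀ j, X.map (LinearMap.mulRight ℚ (y j)) = V := by
    intro j
    have hinj : Function.Injective (LinearMap.mulRight ℚ (y j)) :=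
      fun a b hab => mul_left_injective₀ (hyne j) (by simpa using hab)
    have hle : X.map (LinearMap.mulRight ℚ (y j)) ≤ V := by
      rw [Submodule.map_le_iff_le_comap, hX, Submodule.span_le]
      rintro _ ⟨i, rfl⟩
      simpa using hgrid i j
    refine Submodule.eq_of_le_of_finrank_le hle ?_
    rw [hVn, ← LinearEquiv.finrank_eq (Submodule.equivMapOfInjective _ hinj X), hXn]
  -- the normalised multipliers `y'ⱼ = yⱼ / y₀`
  let y' : Fin 4 → ℂ := fun j => y j * (y 0)⁻¹
  have hy'li : LinearIndependent ℚ y' :=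
    hy.map' (LinearMap.mulRight ℚ (y 0)⁻¹)
      (LinearMap.ker_eq_bot.mpr fun a b hab => mul_left_injective₀ (inv_ne_zero (hyne 0)) (by simpa using hab))
  have hy'M : ∀ j, y' j ∈ multiplierSubalgebra V := by
    intro j v hv
    have hv' : v ∈ X.map (LinearMap.mulRight ℚ (y 0)) := by rw [hU]; exact hv
    obtain ⟨u, hu, rfl⟩ := Submodule.mem_map.mp hv'
    have e : y' j * (LinearMap.mulRight ℚ (y 0) u) = LinearMap.mulRight ℚ (y j) u := by
      simp only [LinearMap.mulRight_apply]
      show y j * (y 0)⁻¹ * (u * y 0) = u * y j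
      calc y j * (y 0)⁻¹ * (u * y 0) = u * y j * ((y 0)⁻¹ * y 0) := by ring
        _ = u * y j := by rw [inv_mul_cancel₀ (hyne 0), mul_one]
    rw [e, ← hU j]
    exact Submodule.mem_map_of_mem hu
  have hy'V : ∀ j i, y' j * z i ∈ Submodule.span ℚ (Set.range z) :=
    fun j i => hy'M j (z i) (Submodule.subset_span ⟨i, rfl⟩)
  have hy'alg : ∀ j, IsAlgebraic ℚ (y' j) :=
    fun j => Summit.Schanuel.Schanuel.Theorems.RootDecomp1ELevels.isAlgebraic_of_multiplier hz (by norm_num) (hy'V j)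
  -- the number field `K = ℚ(y')` consists of multipliers
  set K : IntermediateField ℚ ℂ := IntermediateField.adjoin ℚ (Set.range y') with hK
  have hKM : ∀ k : ℂ, k ∈ K → k ∈ multiplierSubalgebra V := by
    intro k hk
    have hk' : k ∈ K.toSubalgebra := hk
    rw [hK, IntermediateField.adjoin_toSubalgebra_of_isAlgebraic
      (by rintro _ ⟨j, rfl⟩; exact hy'alg j)] at hk'
    exact (Algebra.adjoin_le (by rintro _ ⟨j, rfl⟩; exact hy'M j) : Algebra.adjoin ℚ (Set.range y') ≤
      multiplierSubalgebra V) hk'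
  haveI hKfd : FiniteDimensional ℚ ↥K :=
    IntermediateField.finiteDimensional_adjoin (fun _ ⟨j, hj⟩ => hj ▸ (hy'alg j).isIntegral)
  -- `[K:ℚ] ≥ 4`
  have h4K : 4 ≤ Module.finrank ℚ ↥K := by
    let yK : Fin 4 → ↥K := fun j => ⟨y' j, IntermediateField.subset_adjoin ℚ _ ⟨j, rfl⟩⟩
    have hyK : LinearIndependent ℚ yK :=
      LinearIndependent.of_comp (K.val.toLinearMap) (by simpa [yK, Function.comp_def] using hy'li)
    simpa using hyK.fintype_card_le_finrank
  -- a primitive element of `K` is a multiplier of degree `[K:ℚ] ∣ 4`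
  obtain ⟨α, hα⟩ := Field.exists_primitive_element ℚ ↥K
  have hdegK : (minpoly ℚ α).natDegree = Module.finrank ℚ ↥K :=
    (Field.primitive_element_iff_minpoly_natDegree_eq ℚ α).mp hα
  have hmin : minpoly ℚ (α : ℂ) = minpoly ℚ α := (IntermediateField.minpoly_eq α).symm
  have hαV : ∀ i, (α : ℂ) * z i ∈ Submodule.span ℚ (Set.range z) :=
    fun i => hKM (α : ℂ) α.2 (z i) (Submodule.subset_span ⟨i, rfl⟩)
  have hαalg : IsAlgebraic ℚ (α : ℂ) :=
    Summit.Schanuel.Schanuel.Theorems.RootDecomp1ELevels.isAlgebraic_of_multiplier hz (by norm_num) hαV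
  have hdvd : (minpoly ℚ (α : ℂ)).natDegree ∣ 4 := degree_dvd z hz hαalg hαV
  have hle : (minpoly ℚ (α : ℂ)).natDegree ≤ 4 := Nat.le_of_dvd (by norm_num) hdvd
  refine ⟨α, hαalg, ?_, hαV⟩
  rw [hmin, hdegK] at hle ⊢
  rw [hmin, hdegK] at hdvd
  omega

/-- **THE DICTIONARY**: on ℚ-free quadruples, FULL `(4,4)` SPAN-GRID ⟺ K-LINE. -/
theorem fullGridFour_iff_kline {z : Fin 4 → ℂ} (hz : LinearIndependent ℚ z) :
    Summit.Schanuel.Schanuel.Theorems.RootDecomp1ELevels.FullGridFour z ↔ IsKLine z :=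
  ⟨kline_of_fullGridFour hz, fullGridFour_of_kline hz⟩

/-- Hence a K-MODULE of length `4` carries NO full grid … -/
theorem not_fullGridFour_of_kmodule {z : Fin 4 → ℂ} (hz : LinearIndependent ℚ z) (hK : IsKModule z) :
    ¬ Summit.Schanuel.Schanuel.Theorems.RootDecomp1ELevels.FullGridFour z :=
  fun hg => not_kmodule_of_kline (kline_of_fullGridFour hz hg) hK

/-- … and **CONJECTURE 2.3 IS INERT ON THE WHOLE K-MODULE CELL at `n = 4`**: every span-grid of a K-module quadruple
(`d, ℓ ≥ 1`) has conjectural `t₂`-output `[dℓ/(ℓ+d)] + 1 ≤ 2 = n − 2` (the known floor).  The several-variables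
family, proved or conjectural, bites exactly the K-LINE half of the CM type. -/
theorem conj23_inert_on_kmodule_four {z : Fin 4 → ℂ} (hz : LinearIndependent ℚ z) (hK : IsKModule z)
    {d l : ℕ} {x : Fin d → ℂ} {y : Fin l → ℂ} (hx : LinearIndependent ℚ x) (hy : LinearIndependent ℚ y)
    (hd : 0 < d) (hl : 0 < l) (hgrid : ∀ i j, x i * y j ∈ Submodule.span ℚ (Set.range z)) :
    d * l / (l + d) + 1 ≤ 2 := by
  have hd4 : d ≤ 4 := Summit.Schanuel.Schanuel.Theorems.RootDecomp1ELevels.grid_rows_le hx (hy.ne_zero ⟨0, hl⟩)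
    (fun i => hgrid i ⟨0, hl⟩)
  have hl4 : l ≤ 4 := Summit.Schanuel.Schanuel.Theorems.RootDecomp1ELevels.grid_cols_le hy (hx.ne_zero ⟨0, hd⟩)
    (fun j => hgrid ⟨0, hd⟩ j)
  by_contra h
  push Not at h
  obtain ⟨rfl, rfl⟩ :=
    Summit.Schanuel.Schanuel.Theorems.RootDecomp1ELevels.conj23_t₂_eq_three_only_fullGrid hd4 hl4 (by omega)
  -- a `(4,4)` grid: reindex to `Fin 4 → ℂ` families literally
  exact not_fullGridFour_of_kmodule hz hK ⟨x, y, hx, hy, hgrid⟩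

/-- In particular at the certified member: `G` admits no full grid, Conjecture 2.3 outputs `≤ 2` on `span_ℚ G`. -/
theorem G_not_fullGridFour : ¬ Summit.Schanuel.Schanuel.Theorems.RootDecomp1ELevels.FullGridFour G :=
  not_fullGridFour_of_kmodule G_linearIndependent G_kmodule

/-- … while the cyclotomic member carries the full grid `(ζ₅^i) × (ζ₅^j log 2)`. -/
theorem cycLine_fullGridFour : Summit.Schanuel.Schanuel.Theorems.RootDecomp1ELevels.FullGridFour cycLine :=
  fullGridFour_of_kline cycLine_linearIndependent cycLine_kline


end

end Summit.Schanuel.Schanuel.Theorems.RootDecomp1EMultiplierField
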